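import Summits.Ventures.PercRepro.Night2FatDegSmall
import Summits.Ventures.PercRepro.Night2FatDegWitnessB
import Summits.Ventures.PercRepro.Night2FatDegNumIccA
import Summits.Ventures.PercRepro.Night2FatDegNumIccA2
import Summits.Ventures.PercRepro.Night2FatDegNumIccB

/-!
# night-2: the singly degenerate regime at `N = 6, 7, 8` — every lossy basis pair

**`basis_pair_fair_fat_deg_small`**: with the witnesses of `exists_small_witnesses_deg` (patterns (α)–(δ)) and the
numerics `Night2FatDegNumIccA/B`, every lossy basis pair of the singly degenerate regime with `6 ≤ N ≤ 8` has the fair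
share.  Paper `proofs/NIGHT-2-g35.md` §5.
-/

namespace PercRepro.Shadow

open PercRepro.ThmH PercRepro.PerFlat

variable {α : Type*} [DecidableEq α] {M : Matroid α} [M.Finite] {G : Finset α}

/-- **THE SINGLY DEGENERATE REGIME AT `N = 6, 7, 8`: every lossy basis pair has the fair share.** -/
theorem basis_pair_fair_fat_deg_small (hG : G ∈ flatsQ M (5 + 1)) (hd : (gr M \ G).card = 2)
    (hk : kColoops M G = 1) (hs : ∀ e ∈ gr M, ∀ f ∈ gr M, e ≠ f → rkN M {e, f} = 2)
    (hl : ∀ e ∈ gr M, M.Indep {e}) (hfat : (fatClosures M 5 G 2).card ≤ 1) {B₀ : Finset α}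
    (hB₀ : B₀ ∈ thinMembers M 5 G) {w₀ x : α} (hD : G \ clF M B₀ = {w₀, x}) (hne : w₀ ≠ x) {R₁ : Finset α}
    (hR₁V : R₁ ⊆ (G \ coloops M G) \ {w₀, x}) (hR₁2 : rkN M R₁ = 2) (hR₁3 : 3 ≤ R₁.card)
    (hcop : rkN M (insert w₀ (insert x R₁)) ≤ 3) {c₂ c₃ : α}
    (hc₂V : c₂ ∈ (G \ coloops M G) \ {w₀, x}) (hc₃V : c₃ ∈ (G \ coloops M G) \ {w₀, x})
    (hc₂ : c₂ ∉ clF M R₁) (hc₃ : c₃ ∉ clF M (insert c₂ R₁))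
    (hcover : ∀ e ∈ (G \ coloops M G) \ {w₀, x}, e ∈ clF M (insert c₂ R₁) ∨ e ∈ clF M (insert c₃ R₁))
    (hnd₂ : 3 ≤ rkN M (((G \ coloops M G) \ {w₀, x}).filter
      (fun e => e ∈ clF M (insert c₂ R₁) ∧ e ∉ clF M R₁)))
    (hdeg₃ : rkN M (((G \ coloops M G) \ {w₀, x}).filter
      (fun e => e ∈ clF M (insert c₃ R₁) ∧ e ∉ clF M R₁)) ≤ 2)
    {B : Finset α} (hB : B ∈ thinMembers M 5 G) (hnP : ¬ bigP M G B) {z : α} (hz : z ∈ G \ clF M B)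
    (hl0 : loss M 5 G B z ≠ 0) (hw₀ : w₀ ∈ insert z B) (hx : x ∉ insert z B) (hN6 : 6 ≤ (G \ insert z B).card)
    (hN8 : (G \ insert z B).card ≤ 8) :
    loss M 5 G B z ≤ rhoL M 5 G B z * lossIncomeH M 5 G (bigP M G) (dshGT2 M 5 G) B z := by
  obtain ⟨U, V, E, hU, hUs, hV, hVf, hE, hEc, hpat⟩ := exists_small_witnesses_deg hG hd hk hs hfat hB₀ hD hne
    hR₁V hR₁2 hR₁3 hcop hc₂V hc₃V hc₂ hc₃ hcover hnd₂ hdeg₃ hB hnP hz hw₀ hx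
  have hN3 : 3 ≤ (G \ insert z B).card := by omega
  rcases hpat with ⟨hM, hUc, hVc, hEc2⟩ | ⟨hUc, hVc, hEc2⟩ | ⟨hUc, hVc, hEc1⟩ | ⟨hUc, hVc, hEc3⟩
  · -- pattern (α): family B2 with `(μ, φ) = (2, 1)`
    apply basis_pair_fair_fat_deg_of_sets_B2 hG hd hk hs hl hfat hB₀ hD hne hR₁V hR₁2 hR₁3 hc₂V hc₃V hc₂ hc₃
      hcover hnd₂ hB hnP hz hl0 hw₀ hx hN3 hM hU hUs hV hVf hE hEc
    intro s hsb
    rw [hUc, hVc] at hsb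
    rcases (by omega : (G \ insert z B).card = 6 ∨ (G \ insert z B).card = 7 ∨ (G \ insert z B).card = 8) with
      hN | hN | hN
    · rw [hN] at hsb ⊢
      exact numeric_icc_B2_N6_mu2_phi1_e2 E.card s hEc2 (hsb 3 (by norm_num) (by norm_num))
        (hsb 4 (by norm_num) (by norm_num)) (hsb 5 (by norm_num) (by norm_num)) (hsb 6 (by norm_num) (by norm_num))
    · rw [hN] at hsb ⊢
      exact numeric_icc_B2_N7_mu2_phi1_e0 E.card s (Nat.zero_le _) (hsb 3 (by norm_num) (by norm_num))
        (hsb 4 (by norm_num) (by norm_num)) (hsb 5 (by norm_num) (by norm_num)) (hsb 6 (by norm_num) (by norm_num))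
        (hsb 7 (by norm_num) (by norm_num))
    · rw [hN] at hsb ⊢
      exact numeric_icc_B2_N8_mu2_phi1_e0 E.card s (Nat.zero_le _) (hsb 3 (by norm_num) (by norm_num))
        (hsb 4 (by norm_num) (by norm_num)) (hsb 5 (by norm_num) (by norm_num)) (hsb 6 (by norm_num) (by norm_num))
        (hsb 7 (by norm_num) (by norm_num)) (hsb 8 (by norm_num) (by norm_num))
  · -- pattern (β): family B1 with `(μ, φ) = (1, 3)`
    apply basis_pair_fair_fat_deg_of_sets_B1 hG hd hk hs hl hfat hB₀ hD hne hR₁V hR₁2 hR₁3 hc₂V hc₃V hc₂ hc₃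
      hcover hnd₂ hB hnP hz hl0 hw₀ hx hN3 hU hUs hV hVf hE hEc
    intro s hsb
    rw [hUc, hVc] at hsb
    rcases (by omega : (G \ insert z B).card = 6 ∨ (G \ insert z B).card = 7 ∨ (G \ insert z B).card = 8) with
      hN | hN | hN
    · rw [hN] at hsb ⊢
      exact numeric_icc_B1_N6_mu1_phi3_e2 E.card s hEc2 (hsb 3 (by norm_num) (by norm_num))
        (hsb 4 (by norm_num) (by norm_num)) (hsb 5 (by norm_num) (by norm_num)) (hsb 6 (by norm_num) (by norm_num))
    · rw [hN] at hsb ⊢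
      exact numeric_icc_B1_N7_mu1_phi3_e1 E.card s (by omega) (hsb 3 (by norm_num) (by norm_num))
        (hsb 4 (by norm_num) (by norm_num)) (hsb 5 (by norm_num) (by norm_num)) (hsb 6 (by norm_num) (by norm_num))
        (hsb 7 (by norm_num) (by norm_num))
    · rw [hN] at hsb ⊢
      exact numeric_icc_B1_N8_mu1_phi3_e0 E.card s (Nat.zero_le _) (hsb 3 (by norm_num) (by norm_num))
        (hsb 4 (by norm_num) (by norm_num)) (hsb 5 (by norm_num) (by norm_num)) (hsb 6 (by norm_num) (by norm_num))
        (hsb 7 (by norm_num) (by norm_num)) (hsb 8 (by norm_num) (by norm_num))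
  · -- pattern (γ): family B1 with `(μ, φ) = (2, 2)`
    apply basis_pair_fair_fat_deg_of_sets_B1 hG hd hk hs hl hfat hB₀ hD hne hR₁V hR₁2 hR₁3 hc₂V hc₃V hc₂ hc₃
      hcover hnd₂ hB hnP hz hl0 hw₀ hx hN3 hU hUs hV hVf hE hEc
    intro s hsb
    rw [hUc, hVc] at hsb
    rcases (by omega : (G \ insert z B).card = 6 ∨ (G \ insert z B).card = 7 ∨ (G \ insert z B).card = 8) with
      hN | hN | hN
    · rw [hN] at hsb ⊢
      exact numeric_icc_B1_N6_mu2_phi2_e1 E.card s hEc1 (hsb 3 (by norm_num) (by norm_num))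
        (hsb 4 (by norm_num) (by norm_num)) (hsb 5 (by norm_num) (by norm_num)) (hsb 6 (by norm_num) (by norm_num))
    · rw [hN] at hsb ⊢
      exact numeric_icc_B1_N7_mu2_phi2_e0 E.card s (Nat.zero_le _) (hsb 3 (by norm_num) (by norm_num))
        (hsb 4 (by norm_num) (by norm_num)) (hsb 5 (by norm_num) (by norm_num)) (hsb 6 (by norm_num) (by norm_num))
        (hsb 7 (by norm_num) (by norm_num))
    · rw [hN] at hsb ⊢
      exact numeric_icc_B1_N8_mu2_phi2_e0 E.card s (Nat.zero_le _) (hsb 3 (by norm_num) (by norm_num))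
        (hsb 4 (by norm_num) (by norm_num)) (hsb 5 (by norm_num) (by norm_num)) (hsb 6 (by norm_num) (by norm_num))
        (hsb 7 (by norm_num) (by norm_num)) (hsb 8 (by norm_num) (by norm_num))
  · -- pattern (δ): family B1 with `(μ, φ) = (1, 2)`
    apply basis_pair_fair_fat_deg_of_sets_B1 hG hd hk hs hl hfat hB₀ hD hne hR₁V hR₁2 hR₁3 hc₂V hc₃V hc₂ hc₃
      hcover hnd₂ hB hnP hz hl0 hw₀ hx hN3 hU hUs hV hVf hE hEc
    intro s hsb
    rw [hUc, hVc] at hsb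
    rcases (by omega : (G \ insert z B).card = 6 ∨ (G \ insert z B).card = 7 ∨ (G \ insert z B).card = 8) with
      hN | hN | hN
    · rw [hN] at hsb ⊢
      exact numeric_icc_B1_N6_mu1_phi2_e3 E.card s hEc3 (hsb 3 (by norm_num) (by norm_num))
        (hsb 4 (by norm_num) (by norm_num)) (hsb 5 (by norm_num) (by norm_num)) (hsb 6 (by norm_num) (by norm_num))
    · rw [hN] at hsb ⊢
      exact numeric_icc_B1_N7_mu1_phi2_e2 E.card s (by omega) (hsb 3 (by norm_num) (by norm_num))
        (hsb 4 (by norm_num) (by norm_num)) (hsb 5 (by norm_num) (by norm_num)) (hsb 6 (by norm_num) (by norm_num))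
        (hsb 7 (by norm_num) (by norm_num))
    · rw [hN] at hsb ⊢
      exact numeric_icc_B1_N8_mu1_phi2_e1 E.card s (by omega) (hsb 3 (by norm_num) (by norm_num))
        (hsb 4 (by norm_num) (by norm_num)) (hsb 5 (by norm_num) (by norm_num)) (hsb 6 (by norm_num) (by norm_num))
        (hsb 7 (by norm_num) (by norm_num)) (hsb 8 (by norm_num) (by norm_num))

end PercRepro.Shadow
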